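import Literature.MathematicalPhysics.QuantumLattice.QuasiLocalAlgebraProofs
import Mathlib.Analysis.Calculus.MeanValue
import Mathlib.Analysis.Calculus.Deriv.Mul
import Mathlib.Analysis.SpecificLimits.Normed
import Mathlib.Analysis.Complex.Exponential
import HarnessLib

/-!
# Discharged fact: uniqueness of the finite-range dynamics and covariance under translations
(`QuasiLocalAlgebra.IsDynamicsOf.shift_comm`)

This file contains only theorems. It discharges the named fact
`Literature.MathematicalPhysics.QuantumLattice.QuasiLocalAlgebra.IsDynamicsOf.shift_comm` of
`Literature.MathematicalPhysics.QuantumLattice.QuasiLocalAlgebra`: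
for a translation-invariant interaction `Φ` of finite range `R`, every strongly continuous
automorphism group `τ` of the quasi-local algebra `𝔄` whose generator is the commutator derivation
of `Φ` on the local algebra (`𝔄.IsDynamicsOf τ Φ R`) commutes with the lattice translations,
`τ_t ∘ shift_v = shift_v ∘ τ_t` (`IsDynamicsOf.shift_comm_holds`; Bratteli–Robinson II
Thm. 6.2.4, eq. (6.2.11)). It is a sibling of `QuasiLocalAlgebraProofs.lean` (ground states and
translation-invariant states), which it imports for the elementary group-law lemmas
`IsAutomorphismGroup.map_zero_apply` / `map_add_apply`.

## Proof (Bratteli–Robinson II Thm. 6.2.4; Ruelle 1969, §7.6)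

`IsDynamicsOf` only prescribes the derivative of `t ↦ τ_t(a)` at `t = 0` for strictly local `a`, so
the content of the fact is the **uniqueness of the dynamics** (`IsDynamicsOf.eq_of_isDynamicsOf`,
the `∃!` half of BR II Thm. 6.2.4): `shift_v⁻¹ ∘ τ_t ∘ shift_v` is again a dynamics of `Φ`
(`IsDynamicsOf.conj_shift`, covariance of the generator), hence equals `τ_t`.
Uniqueness is the analytic-vector argument with a *uniform* radius of analyticity:
* `ι_derivation`: inside `𝔄` the generator is the inner commutator sum
  `ι(δ(A)) = i Σ_{X ⊆ Λ_R} [ι_X(Φ X), ι_Λ(A)]`; iterating gives a chain `x₀ = ι_Λ(A), x₁, x₂, …`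
  with `d/dt τ_t(x_n)|₀ = x_{n+1}` for *every* dynamics `τ` of `Φ`
  (`IsDynamicsOf.hasDerivAt_iterate_genStep`);
* `norm_iterate_genStep_le` is Ruelle's chain estimate (Ruelle 1969, Lemma 7.6.1, eqs. (6.4)–(6.6),
  pp. 168–169; BR II Thm. 6.2.4, proof): only regions meeting the current support contribute
  (`sum_comm_eq_sum_nbhd`, by locality `ι_commute_of_disjoint` and finite range), whence
  `‖x_n‖ ≤ ‖x₀‖ (2J·2^m)ⁿ Π_{k<n} (|Λ| + k m) ≤ ‖x₀‖ e^{|Λ|} n! Kⁿ` with `m = (2⌊R⌋+1)^d` and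
  `K = 2 J 2^m e^m` independent of `Λ` (`norm_iterate_genStep_le_factorial`);
* `IsAutomorphismGroup.tendsto_taylor`: for any strongly continuous group of ⋆-automorphisms and
  any such chain, `Σ_{n≤N} tⁿ/n! x_n → τ_t(x₀)` for `|t| K < 1` (differentiate
  `s ↦ Σ_{n≤N} sⁿ/n! τ_{-s}(x_n)`, which telescopes, and use the mean value inequality and the
  isometry of automorphisms; Ruelle 1969 Thm. 7.6.2 (a), (d), pp. 169–170; Sakai 1991 §3.4, p. 86,
  analytic elements);
* two dynamics of `Φ` therefore agree on the dense local algebra for `|t| K < 1`, hence everywhere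
  by continuity, hence for all `t` by the group law.
The bound `‖ι_X(Φ X)‖ ≤ J` needed for the estimate follows from translation invariance and finite
range (`norm_ι_le_of_isTranslationInvariant`: translate a point of `X` to the origin; translations
are isometric), so no boundedness or Hermiticity hypothesis is required, exactly as in the fact.

## Design notes

* Everything is computed inside the C⋆-algebra `𝔄` (images `ι_X(Φ X)`), using only the structure
  fields `ι_compatible`, `ι_commute_of_disjoint`, `dense_range`, `shift_ι` and Mathlib's automatic
  isometry of ⋆-isomorphisms (`StarAlgEquiv.norm_map`); the only matrix-level identity is
  `localOp_transportOp_symm_eq_embedOp` (the terms of `LatticeInteraction.restrict` are `embedOp`s).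
* The iterated generator with its growing region,
  `G : (Λ', y) ↦ (thicken Λ' R, i Σ_{X ⊆ thicken Λ' R} [ι_X(Φ X), y])`, enters the chain lemmas
  through a defining hypothesis `hG` (section `Iterate`) rather than as a definition, so that this
  proof file declares theorems only; `IsDynamicsOf.eq_of_isDynamicsOf` instantiates it.

## References

* O. Bratteli, D. W. Robinson, *Operator Algebras and Quantum Statistical Mechanics II*
  (2nd ed., Springer 1997), §6.2.1 (quantum spin systems, space translations
  `τ_x(𝔄_Λ) = 𝔄_{Λ+x}`); Thm. 6.2.4 and eqs. (6.2.9)–(6.2.11) (existence and uniqueness of the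
  dynamics of a finite-range interaction, covariance under translations; not held locally,
  acquisition requested — the statements used here are those vendored in
  `QuasiLocalAlgebra.lean`). [BratteliRobinsonII1997]
* D. Ruelle, *Statistical Mechanics: Rigorous Results* (Benjamin 1969), §7.6, pp. 168–170:
  Lemma 7.6.1 (eq. (6.4), the commutator estimate, with the chain argument (6.5)–(6.6)),
  Thm. 7.6.2 (the dynamics as a power series for `|t| < (2‖Φ‖₁)⁻¹`, extended by the group law),
  and p. 170 (`τ_x τ̄_t = τ̄_t τ_x`). [Ruelle1969]
* S. Sakai, *Operator Algebras in Dynamical Systems* (Cambridge University Press 1991), §3.4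
  p. 86 (analytic elements); §4.1 p. 118 (translation-invariant finite-range interactions:
  `A(δ) = D(δ)`). [Sakai1991]
* O. Bratteli, D. W. Robinson, *Operator Algebras and Quantum Statistical Mechanics I*
  (2nd ed., Springer 1987), Def. 2.7.1 (C⋆-dynamical systems), Def. 2.6.3 (quasi-local
  algebras).
-/

noncomputable section

open Matrix Complex Finset Filter Topology
open scoped Matrix.Norms.L2Operator ComplexOrder InnerProductSpace Nat

namespace Literature.MathematicalPhysics.QuantumLattice

/-! ### Analytic vectors of a one-parameter automorphism group -/

section CStar

variable {A : Type*} [CStarAlgebra A]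

/-- A ⋆-automorphism of a C⋆-algebra commutes with derivatives of curves (it is a continuous
real-linear map, being isometric: Mathlib `StarAlgEquiv.isometry`). [folklore] -/
theorem hasDerivAt_starAlgEquiv_apply (e : A ≃⋆ₐ[ℂ] A) {f : ℝ → A} {f' : A} {x : ℝ}
    (hf : HasDerivAt f f' x) : HasDerivAt (fun t => e (f t)) (e f') x := by
  let L : A →L[ℝ] A :=
    { toFun := e
      map_add' := map_add e
      map_smul' := fun r a => by
        rw [RingHom.id_apply, ← Complex.coe_smul, map_smul, Complex.coe_smul]
      cont := (StarAlgEquiv.isometry e).continuous }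
  exact L.hasFDerivAt.comp_hasDerivAt x hf

namespace IsAutomorphismGroup

variable {τ : ℝ → (A ≃⋆ₐ[ℂ] A)}

/-- `τ_t(τ_{-t}(a)) = a`. Bratteli–Robinson I Def. 2.7.1. [folklore] -/
theorem apply_neg_apply (hτ : IsAutomorphismGroup τ) (t : ℝ) (a : A) : τ t (τ (-t) a) = a := by
  rw [← hτ.map_add_apply, add_neg_cancel, hτ.map_zero_apply]

/-- The derivative of an orbit `t ↦ τ_t(y)` at `s` is `τ_s` of its derivative at `0` (group law;
the standard computation for the generator of a `C₀`-group). Sakai (1991) §3.4. [folklore] -/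
theorem hasDerivAt_of_hasDerivAt_zero (hτ : IsAutomorphismGroup τ) {y y' : A}
    (h : HasDerivAt (fun t => τ t y) y' 0) (s : ℝ) :
    HasDerivAt (fun t => τ t y) (τ s y') s := by
  have h1 : (fun t => τ t y) = fun t => τ s (τ (t - s) y) := by
    funext t
    rw [← hτ.map_add_apply, add_sub_cancel]
  rw [h1]
  refine hasDerivAt_starAlgEquiv_apply (τ s) ?_
  exact HasDerivAt.comp_sub_const s s (by rwa [sub_self])

/-- The derivative of the reversed orbit `s ↦ τ_{-s}(y)` is `-τ_{-s}(y')`. Sakai (1991) §3.4.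
[folklore] -/
theorem hasDerivAt_neg (hτ : IsAutomorphismGroup τ) {y y' : A}
    (h : HasDerivAt (fun t => τ t y) y' 0) (s : ℝ) :
    HasDerivAt (fun t => τ (-t) y) (-(τ (-s) y')) s := by
  have := (hτ.hasDerivAt_of_hasDerivAt_zero h (-s)).scomp s (hasDerivAt_neg' s)
  simpa [Function.comp_def, neg_one_smul] using this

/-- **Taylor expansion of an orbit along a chain of derivatives.** If `x₀, x₁, …` satisfy
`d/dt τ_t(x_n)|₀ = x_{n+1}`, then for every `N` the function
`g_N(s) = Σ_{n ≤ N} (sⁿ/n!) τ_{-s}(x_n)` has derivative `-(s^N/N!) τ_{-s}(x_{N+1})` (telescoping).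
Ruelle (1969) §7.6, eq. (6.2), p. 168; Sakai (1991) §3.4, p. 86 (analytic elements). [folklore] -/
theorem hasDerivAt_taylor_aux (hτ : IsAutomorphismGroup τ) (x : ℕ → A)
    (hx : ∀ n, HasDerivAt (fun t => τ t (x n)) (x (n + 1)) 0) (N : ℕ) (s : ℝ) :
    HasDerivAt (fun u : ℝ => ∑ n ∈ range (N + 1), (u ^ n / n ! : ℝ) • τ (-u) (x n))
      (-((s ^ N / N ! : ℝ) • τ (-s) (x (N + 1)))) s := by
  induction N with
  | zero =>
    simp only [zero_add, range_one, sum_singleton, pow_zero, Nat.factorial_zero, Nat.cast_one,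
      div_one, one_smul]
    exact hτ.hasDerivAt_neg (hx 0) s
  | succ N ih =>
    have hterm : HasDerivAt (fun u : ℝ => (u ^ (N + 1) / (N + 1)! : ℝ) • τ (-u) (x (N + 1)))
        ((s ^ N / N ! : ℝ) • τ (-s) (x (N + 1)) +
          -((s ^ (N + 1) / (N + 1)! : ℝ) • τ (-s) (x (N + 2)))) s := by
      have hc : HasDerivAt (fun u : ℝ => (u ^ (N + 1) / (N + 1)! : ℝ)) (s ^ N / N !) s := by
        refine ((hasDerivAt_pow (N + 1) s).div_const ((N + 1)! : ℝ)).congr_deriv ?_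
        rw [Nat.factorial_succ, Nat.cast_mul, Nat.cast_add, Nat.cast_one, Nat.add_sub_cancel]
        field_simp
      refine (hc.smul (hτ.hasDerivAt_neg (hx (N + 1)) s)).congr_deriv ?_
      rw [smul_neg, add_comm]
    have heq : (fun u : ℝ => ∑ n ∈ range (N + 1 + 1), (u ^ n / n ! : ℝ) • τ (-u) (x n)) =
        fun u : ℝ => (∑ n ∈ range (N + 1), (u ^ n / n ! : ℝ) • τ (-u) (x n)) +
          (u ^ (N + 1) / (N + 1)! : ℝ) • τ (-u) (x (N + 1)) := by
      funext u
      rw [sum_range_succ]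
    rw [heq]
    refine (ih.add hterm).congr_deriv ?_
    abel

/-- **Orbits of analytic chains are given by their Taylor series.** Let `τ` be a strongly continuous
one-parameter group of ⋆-automorphisms and `x : ℕ → A` a chain of derivatives at `0`
(`d/dt τ_t(x_n)|₀ = x_{n+1}`) with `‖x_n‖ ≤ C n! Kⁿ`. Then for `|t| K < 1` the Taylor polynomials
`Σ_{n ≤ N} (tⁿ/n!) x_n` converge to `τ_t(x_0)`. This is the uniqueness half of the analytic-vector
argument: it holds for *every* such `τ`. Ruelle (1969) Thm. 7.6.2 (a), (d), pp. 169–170;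
Sakai (1991) §3.4, p. 86 (analytic elements); Bratteli–Robinson II Thm. 6.2.4 (proof).
[cite: Ruelle1969, Thm. 7.6.2 (a) and (d), pp. 169-170] -/
theorem tendsto_taylor (hτ : IsAutomorphismGroup τ) (x : ℕ → A)
    (hx : ∀ n, HasDerivAt (fun t => τ t (x n)) (x (n + 1)) 0) {C K : ℝ} (hK : 0 ≤ K)
    (hb : ∀ n, ‖x n‖ ≤ C * n ! * K ^ n) {t : ℝ} (ht : |t| * K < 1) :
    Tendsto (fun N => ∑ n ∈ range (N + 1), (t ^ n / n ! : ℝ) • x n) atTop (𝓝 (τ t (x 0))) := by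
  have hC : 0 ≤ C := by
    have := (norm_nonneg (x 0)).trans (hb 0)
    simpa using this
  -- the key estimate
  have key : ∀ N : ℕ, ‖(∑ n ∈ range (N + 1), (t ^ n / n ! : ℝ) • x n) - τ t (x 0)‖ ≤
      C * (N + 1) * (|t| * K) ^ (N + 1) := by
    intro N
    set g : ℝ → A := fun u => ∑ n ∈ range (N + 1), (u ^ n / n ! : ℝ) • τ (-u) (x n) with hg
    have hg0 : g 0 = x 0 := by
      rw [hg]
      simp only
      rw [sum_range_succ']
      simp [hτ.map_zero_apply]
    have hgt : τ t (g t) = ∑ n ∈ range (N + 1), (t ^ n / n ! : ℝ) • x n := by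
      rw [hg]
      simp only [map_sum]
      refine sum_congr rfl fun n _ => ?_
      rw [← Complex.coe_smul, map_smul, Complex.coe_smul, hτ.apply_neg_apply]
    -- mean value inequality on the segment `[0, t]`
    have hderiv : ∀ u ∈ Set.uIcc 0 t, HasDerivWithinAt g
        (-((u ^ N / N ! : ℝ) • τ (-u) (x (N + 1)))) (Set.uIcc 0 t) u :=
      fun u _ => (hτ.hasDerivAt_taylor_aux x hx N u).hasDerivWithinAt
    have hbound : ∀ u ∈ Set.uIcc 0 t, ‖-((u ^ N / N ! : ℝ) • τ (-u) (x (N + 1)))‖ ≤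
        |t| ^ N / N ! * (C * (N + 1)! * K ^ (N + 1)) := by
      intro u hu
      rw [norm_neg, norm_smul, StarAlgEquiv.norm_map (τ (-u)), Real.norm_eq_abs, abs_div, abs_pow,
        Nat.abs_cast]
      refine mul_le_mul ?_ (hb (N + 1)) (norm_nonneg _) (by positivity)
      refine div_le_div_of_nonneg_right (pow_le_pow_left₀ (abs_nonneg u) ?_ N) (by positivity)
      exact Set.abs_sub_left_of_mem_uIcc hu |>.trans_eq' (by simp) |>.trans (by simp)
    have hmv := (convex_uIcc (0 : ℝ) t).norm_image_sub_le_of_norm_hasDerivWithin_le hderiv hbound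
      Set.left_mem_uIcc Set.right_mem_uIcc
    rw [hg0, sub_zero, Real.norm_eq_abs] at hmv
    calc ‖(∑ n ∈ range (N + 1), (t ^ n / n ! : ℝ) • x n) - τ t (x 0)‖
        = ‖τ t (g t - x 0)‖ := by rw [map_sub, hgt]
      _ = ‖g t - x 0‖ := StarAlgEquiv.norm_map (τ t) _
      _ ≤ |t| ^ N / N ! * (C * (N + 1)! * K ^ (N + 1)) * |t| := hmv
      _ = C * (N + 1) * (|t| * K) ^ (N + 1) := by
        rw [Nat.factorial_succ, Nat.cast_mul, Nat.cast_add, Nat.cast_one]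
        field_simp
        ring
  -- the right-hand side tends to zero
  have hlim : Tendsto (fun N : ℕ => C * (N + 1) * (|t| * K) ^ (N + 1)) atTop (𝓝 0) := by
    have h1 : Tendsto (fun N : ℕ => ((N : ℝ) + 1) * (|t| * K) ^ (N + 1)) atTop (𝓝 0) := by
      have h0 := tendsto_self_mul_const_pow_of_abs_lt_one
        (r := |t| * K) (by rwa [abs_mul, abs_abs, abs_of_nonneg hK])
      have := (tendsto_add_atTop_iff_nat 1).2 h0
      simpa [Nat.cast_add, Nat.cast_one] using this
    simpa [mul_assoc] using h1.const_mul C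
  rw [tendsto_iff_norm_sub_tendsto_zero]
  exact squeeze_zero (fun N => norm_nonneg _) key hlim

end IsAutomorphismGroup

end CStar

section QLattice

open Literature.Probability.LatticeModels
open Literature.Probability.LatticeModels (Site box mem_box)

variable {d q : ℕ}

/-! ### The generator on local elements, inside `𝔄` -/

/-- The term `Φ X ⊗ 𝟙` of the restricted interaction (a `localOp` of the transported matrix) is the
isotony embedding `embedOp` of `Φ X`. Bratteli–Robinson II §6.2.1 (isotony). [folklore] -/
theorem localOp_transportOp_symm_eq_embedOp {Λ' : Finset (Site d)} (X' : Finset ↥Λ')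
    (M : Op ↥(X'.map (Function.Embedding.subtype (· ∈ Λ'))) q)
    (h : X'.map (Function.Embedding.subtype (· ∈ Λ')) ⊆ Λ') :
    localOp X' (transportOp (finsetMapEquiv (Function.Embedding.subtype (· ∈ Λ')) X').symm M) =
      embedOp h M := by
  have hmem : ∀ y : ↥Λ', ((y : Site d) ∉ X'.map (Function.Embedding.subtype (· ∈ Λ'))) ↔ y ∉ X' :=
    fun y => not_congr (Finset.mem_map' _)
  have hpt : ∀ x : ↥(X'.map (Function.Embedding.subtype (· ∈ Λ'))),
      ((finsetMapEquiv (Function.Embedding.subtype (· ∈ Λ')) X').symm x : ↥Λ') = ⟨x, h x.2⟩ := by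
    intro x
    obtain ⟨y, rfl⟩ := (finsetMapEquiv _ X').surjective x
    rw [Equiv.symm_apply_apply]
    rfl
  ext σ τ
  simp only [localOp_apply, embedOp, of_apply, transportOp, reindex_apply, submatrix_apply,
    Equiv.arrowCongr_symm, Equiv.symm_symm, hmem]
  split_ifs
  · congr 1 <;> funext x <;> simp [Equiv.arrowCongr_apply, hpt]
  · rfl

namespace QuasiLocalAlgebra

/-- The image in `𝔄` of the local Hamiltonian `H_{Λ'} = Σ_{X ⊆ Λ'} Φ X ⊗ 𝟙` is `Σ_{X ⊆ Λ'} ι_X(Φ X)`.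
Bratteli–Robinson II §6.2.1, eq. (6.2.4). [folklore] -/
theorem map_localHamiltonian_restrict (𝔄 : QuasiLocalAlgebra d q) (Φ : LatticeInteraction d q)
    (Λ' : Finset (Site d)) :
    𝔄.ι Λ' (localHamiltonian (Φ.restrict Λ') univ) = ∑ X ∈ Λ'.powerset, 𝔄.ι X (Φ X) := by
  classical
  rw [localHamiltonian, map_sum, powerset_univ]
  refine Finset.sum_nbij' (fun X' => X'.map (Function.Embedding.subtype (· ∈ Λ')))
    (fun X => X.subtype (· ∈ Λ')) ?_ ?_ ?_ ?_ ?_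
  · intro X' _
    exact mem_powerset.2 fun x hx => property_of_mem_map_subtype X' hx
  · intro X _
    exact mem_univ _
  · intro X' _
    ext y
    simp
  · intro X hX
    exact subtype_map_of_mem fun x hx => mem_powerset.1 (mem_coe.1 hX) hx
  · intro X' _
    have h : X'.map (Function.Embedding.subtype (· ∈ Λ')) ⊆ Λ' :=
      fun x hx => property_of_mem_map_subtype X' hx
    change 𝔄.ι Λ' (localOp X' (transportOp
      (finsetMapEquiv (Function.Embedding.subtype _) X').symm
        (Φ (X'.map (Function.Embedding.subtype _))))) = _
    rw [localOp_transportOp_symm_eq_embedOp X' _ h, 𝔄.ι_compatible]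

/-- **The generator on local elements is an inner commutator sum in `𝔄`**:
`ι_{Λ_R}(δ(A)) = i Σ_{X ⊆ Λ_R} [ι_X(Φ X), ι_Λ(A)]`, `Λ_R = thicken Λ R`.
Bratteli–Robinson II Thm. 6.2.4, eq. (6.2.9); Ruelle (1969) §7.6, eq. (6.5). [folklore] -/
theorem ι_derivation (𝔄 : QuasiLocalAlgebra d q) (Φ : LatticeInteraction d q) (R : ℝ)
    (Λ : Finset (Site d)) (A : Op ↥Λ q) :
    𝔄.ι (thicken Λ R) (derivation Φ R Λ A) =
      I • ∑ X ∈ (thicken Λ R).powerset,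
        (𝔄.ι X (Φ X) * 𝔄.ι Λ A - 𝔄.ι Λ A * 𝔄.ι X (Φ X)) := by
  rw [derivation, map_smul, map_sub, map_mul, map_mul, 𝔄.ι_compatible,
    𝔄.map_localHamiltonian_restrict, sum_mul, mul_sum, ← sum_sub_distrib]

end QuasiLocalAlgebra

/-! ### Lattice combinatorics of finite-range interactions -/

/-- Translating a region and translating back. Bratteli–Robinson II §6.2.1. [folklore] -/
theorem map_shift_map_shift_neg (X : Finset (Site d)) (v : Site d) :
    (X.map (Site.shift v).toEmbedding).map (Site.shift (-v)).toEmbedding = X := by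
  rw [Finset.map_map]
  convert Finset.map_refl (s := X)
  ext x
  simp

/-- Translating back and translating a region. Bratteli–Robinson II §6.2.1. [folklore] -/
theorem map_shift_neg_map_shift (X : Finset (Site d)) (v : Site d) :
    (X.map (Site.shift (-v)).toEmbedding).map (Site.shift v).toEmbedding = X := by
  simpa using map_shift_map_shift_neg X (-v)

/-- The `R`-neighbourhood of a translate is the translate of the `R`-neighbourhood.
Bratteli–Robinson II §6.2.1. [folklore] -/
theorem thicken_map_shift (Λ : Finset (Site d)) (R : ℝ) (v : Site d) :
    thicken (Λ.map (Site.shift v).toEmbedding) R =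
      (thicken Λ R).map (Site.shift v).toEmbedding := by
  classical
  simp only [thicken, Finset.map_eq_image, Finset.image_biUnion, Finset.biUnion_image,
    Finset.image_image]
  congr 1
  funext y
  congr 1
  funext w
  simp only [Function.comp_apply, Equiv.coe_toEmbedding, Site.shift_apply]
  abel

/-- The ball of radius `⌊R⌋` around a point of `S` lies in `thicken S R` (by definition).
Bratteli–Robinson II §6.2.1. [folklore] -/
theorem image_box_subset_thicken {S : Finset (Site d)} {x : Site d} (hx : x ∈ S) (R : ℝ) :
    (box d ⌊R⌋₊).image (fun w => x + w) ⊆ thicken S R := by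
  unfold thicken
  exact Finset.subset_biUnion_of_mem (fun y => (box d ⌊R⌋₊).image fun w => y + w) hx

/-- **Finite range, concretely**: a region carrying a nonzero term of an interaction of range `R`
lies in the sup-norm ball of radius `⌊R⌋` around each of its points.
Bratteli–Robinson II §6.2.1 ("finite range"). [folklore] -/
theorem LatticeInteraction.HasFiniteRange.subset_image_box {Φ : LatticeInteraction d q} {R : ℝ}
    (hR : Φ.HasFiniteRange R) {X : Finset (Site d)} (hX : Φ X ≠ 0) {x : Site d} (hx : x ∈ X) :
    X ⊆ (box d ⌊R⌋₊).image (fun w => x + w) := by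
  have hdiam : Metric.diam (X : Set (Site d)) ≤ R := le_of_not_gt fun h => hX (hR X h)
  intro y hy
  have hxy : dist y x ≤ R :=
    (Metric.dist_le_diam_of_mem X.finite_toSet.isBounded hy hx).trans hdiam
  have hR0 : 0 ≤ R := dist_nonneg.trans hxy
  refine mem_image.2 ⟨y - x, ?_, add_sub_cancel x y⟩
  rw [mem_box]
  intro i
  have hi : dist (y i) (x i) ≤ R := (dist_le_pi_dist y x i).trans hxy
  rw [Int.dist_eq] at hi
  have hk : |y i - x i| ≤ (⌊R⌋₊ : ℤ) := by
    rw [Int.natCast_floor_eq_floor hR0, Int.le_floor]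
    push_cast
    exact hi
  rw [abs_le] at hk
  rw [Pi.sub_apply]
  exact hk

/-- The regions of range `≤ ⌊R⌋` meeting `S` number at most `|S| · 2^{|box ⌊R⌋|}`.
Ruelle (1969) §7.6, proof of Lemma 7.6.1. [folklore] -/
theorem card_nbhd_le (S : Finset (Site d)) (R : ℝ) :
    #(S.biUnion fun x => ((box d ⌊R⌋₊).image fun w => x + w).powerset) ≤
      #S * 2 ^ #(box d ⌊R⌋₊) := by
  refine Finset.card_biUnion_le.trans ?_
  refine (Finset.sum_le_card_nsmul _ _ (2 ^ #(box d ⌊R⌋₊)) fun x _ => ?_).trans (by simp)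
  rw [Finset.card_powerset]
  exact Nat.pow_le_pow_right (by norm_num) Finset.card_image_le

/-- A region of range `≤ ⌊R⌋` has at most `|box ⌊R⌋|` sites. Ruelle (1969) §7.6. [folklore] -/
theorem card_le_of_mem_nbhd {S : Finset (Site d)} {R : ℝ} {X : Finset (Site d)}
    (hX : X ∈ S.biUnion fun x => ((box d ⌊R⌋₊).image fun w => x + w).powerset) :
    #X ≤ #(box d ⌊R⌋₊) := by
  obtain ⟨x, -, hx⟩ := Finset.mem_biUnion.1 hX
  exact (Finset.card_le_card (Finset.mem_powerset.1 hx)).trans Finset.card_image_le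

/-- Members of the neighbourhood family of `S ⊆ Λ'` lie in `thicken Λ' R`.
Ruelle (1969) §7.6. [folklore] -/
theorem subset_thicken_of_mem_nbhd {S Λ' : Finset (Site d)} (hS : S ⊆ Λ') {R : ℝ}
    {X : Finset (Site d)}
    (hX : X ∈ S.biUnion fun x => ((box d ⌊R⌋₊).image fun w => x + w).powerset) :
    X ⊆ thicken Λ' R := by
  obtain ⟨x, hxS, hx⟩ := Finset.mem_biUnion.1 hX
  exact (Finset.mem_powerset.1 hx).trans (image_box_subset_thicken (hS hxS) R)

namespace QuasiLocalAlgebra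

/-- **Locality of the commutator sum.** For `y = ι_S(B)` local and `Φ` of range `R`, in
`Σ_{X ∈ P} [ι_X(Φ X), y]` only the regions `X` of range `≤ ⌊R⌋` meeting `S` contribute (the
others either commute with `y` by locality or carry `Φ X = 0`).
Ruelle (1969) §7.6, proof of Lemma 7.6.1 ("we may restrict the summations by the conditions
`X_i ∩ S_i ≠ ∅`"); Bratteli–Robinson II Thm. 6.2.4 (proof). [folklore] -/
theorem sum_comm_eq_sum_nbhd (𝔄 : QuasiLocalAlgebra d q) {Φ : LatticeInteraction d q} {R : ℝ}
    (hR : Φ.HasFiniteRange R) (S : Finset (Site d)) (B : Op ↥S q)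
    {P : Finset (Finset (Site d))}
    (hP : (S.biUnion fun x => ((box d ⌊R⌋₊).image fun w => x + w).powerset) ⊆ P) :
    ∑ X ∈ P, (𝔄.ι X (Φ X) * 𝔄.ι S B - 𝔄.ι S B * 𝔄.ι X (Φ X)) =
      ∑ X ∈ S.biUnion (fun x => ((box d ⌊R⌋₊).image fun w => x + w).powerset),
        (𝔄.ι X (Φ X) * 𝔄.ι S B - 𝔄.ι S B * 𝔄.ι X (Φ X)) := by
  symm
  refine Finset.sum_subset hP fun X _ hXn => ?_
  by_cases hd : Disjoint X S
  · exact sub_eq_zero.2 (𝔄.ι_commute_of_disjoint hd (Φ X) B).eq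
  · obtain ⟨x, hxX, hxS⟩ := Finset.not_disjoint_iff.1 hd
    by_cases h0 : Φ X = 0
    · simp [h0]
    · exact absurd (Finset.mem_biUnion.2 ⟨x, hxS, Finset.mem_powerset.2
        (hR.subset_image_box h0 hxX)⟩) hXn

/-- Each commutator `i[ι_X(Φ X), ι_S(B)]` is again a local element, localised in `S ∪ X`.
Ruelle (1969) §7.6 (`S_{i+1} = X_i ∪ S_i`). [folklore] -/
theorem comm_mem_range (𝔄 : QuasiLocalAlgebra d q) (Φ : LatticeInteraction d q)
    (S X : Finset (Site d)) (B : Op ↥S q) :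
    I • (𝔄.ι X (Φ X) * 𝔄.ι S B - 𝔄.ι S B * 𝔄.ι X (Φ X)) =
      𝔄.ι (S ∪ X) (I • (embedOp subset_union_right (Φ X) * embedOp subset_union_left B -
        embedOp subset_union_left B * embedOp subset_union_right (Φ X))) := by
  rw [map_smul, map_sub, map_mul, map_mul, 𝔄.ι_compatible, 𝔄.ι_compatible]

section Iterate

variable (𝔄 : QuasiLocalAlgebra d q) (Φ : LatticeInteraction d q) (R : ℝ)

/-! In the section `Iterate`, `G` is one step of the iterated generator on `𝔄` together with its
growing region, `(Λ', y) ↦ (Λ'_R, i Σ_{X ⊆ Λ'_R} [ι_X(Φ X), y])` with `Λ'_R = thicken Λ' R`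
(Ruelle's supports `S_{i+1} = S_i ∪ X_i`, coarsened to the `R`-neighbourhood). It enters through the
defining hypothesis `hG` and not as a definition, so that this proof file declares theorems only;
`IsDynamicsOf.eq_of_isDynamicsOf` instantiates it by the explicit function. -/

variable {G : Finset (Site d) × 𝔄.carrier → Finset (Site d) × 𝔄.carrier}
  (hG : ∀ (Λ' : Finset (Site d)) (y : 𝔄.carrier), G (Λ', y) =
    (thicken Λ' R, I • ∑ X ∈ (thicken Λ' R).powerset, (𝔄.ι X (Φ X) * y - y * 𝔄.ι X (Φ X))))

include hG

/-- The iterated generator is additive in the element. Ruelle (1969) §7.6, eq. (6.5). [folklore] -/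
theorem iterate_genStep_sum {ι' : Type*} (s : Finset ι') (n : ℕ) (Λ' : Finset (Site d))
    (f : ι' → 𝔄.carrier) :
    (G^[n] (Λ', ∑ i ∈ s, f i)).2 = ∑ i ∈ s, (G^[n] (Λ', f i)).2 := by
  induction n generalizing Λ' f with
  | zero => rfl
  | succ n ih =>
    have h : (I • ∑ X ∈ (thicken Λ' R).powerset,
        (𝔄.ι X (Φ X) * (∑ i ∈ s, f i) - (∑ i ∈ s, f i) * 𝔄.ι X (Φ X))) =
        ∑ i ∈ s, I • ∑ X ∈ (thicken Λ' R).powerset,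
          (𝔄.ι X (Φ X) * f i - f i * 𝔄.ι X (Φ X)) := by
      simp only [Finset.mul_sum, Finset.sum_mul, ← Finset.sum_sub_distrib, ← Finset.smul_sum]
      rw [Finset.sum_comm]
    simp only [Function.iterate_succ_apply, hG]
    rw [h, ih]

/-- The iterates of a local element `ι_Λ(A)` are the images of the iterated local derivations
`ι_{Λ_n}(δ^n A)`. Bratteli–Robinson II Thm. 6.2.4 (proof); Ruelle (1969) §7.6. [folklore] -/
theorem iterate_genStep_eq_ι (n : ℕ) (Λ : Finset (Site d)) (A : Op ↥Λ q) :
    ∃ (L : Finset (Site d)) (B : Op ↥L q), G^[n] (Λ, 𝔄.ι Λ A) = (L, 𝔄.ι L B) := by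
  induction n with
  | zero => exact ⟨Λ, A, rfl⟩
  | succ n ih =>
    obtain ⟨L, B, h⟩ := ih
    refine ⟨thicken L R, derivation Φ R L B, ?_⟩
    rw [Function.iterate_succ_apply', h, hG, 𝔄.ι_derivation]

/-- For a dynamics `τ` of `Φ`, the iterates `x_n` of a local element form a chain of derivatives:
`d/dt τ_t(x_n)|₀ = x_{n+1}`. Bratteli–Robinson II Thm. 6.2.4, eq. (6.2.9). [folklore] -/
theorem IsDynamicsOf.hasDerivAt_iterate_genStep {τ : ℝ → (𝔄.carrier ≃⋆ₐ[ℂ] 𝔄.carrier)}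
    (hτ : 𝔄.IsDynamicsOf τ Φ R) (Λ : Finset (Site d)) (A : Op ↥Λ q) (n : ℕ) :
    HasDerivAt (fun t => τ t (G^[n] (Λ, 𝔄.ι Λ A)).2)
      (G^[n + 1] (Λ, 𝔄.ι Λ A)).2 0 := by
  obtain ⟨L, B, h⟩ := 𝔄.iterate_genStep_eq_ι Φ R hG n Λ A
  rw [Function.iterate_succ_apply', h, hG]
  simpa only [𝔄.ι_derivation] using hτ.2 L B

/-- **Ruelle's commutator estimate** (Lemma 7.6.1 of Ruelle 1969, eq. (6.4)/(6.6); Bratteli–Robinson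
II Thm. 6.2.4, proof): if `‖ι_X(Φ X)‖ ≤ J` for all `X` and `Φ` has range `R`, then for `y = ι_S(B)`
with `S ⊆ Λ'` the `n`-th iterate satisfies
`‖δ^n y‖ ≤ ‖y‖ (2 J 2^m)^n Π_{k<n} (|S| + k m)`, `m = |box ⌊R⌋| = (2⌊R⌋+1)^d`
(sum over chains `X_1, …, X_n` with `X_k ∩ (S ∪ X_1 ∪ ⋯ ∪ X_{k-1}) ≠ ∅`).
[cite: Ruelle1969, Lemma 7.6.1, eqs. (6.4)-(6.6), pp. 168-169] -/
theorem norm_iterate_genStep_le {J : ℝ} (hR : Φ.HasFiniteRange R)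
    (hJ : ∀ X : Finset (Site d), ‖𝔄.ι X (Φ X)‖ ≤ J) (n : ℕ) (Λ' S : Finset (Site d))
    (hS : S ⊆ Λ') (B : Op ↥S q) :
    ‖(G^[n] (Λ', 𝔄.ι S B)).2‖ ≤
      ‖𝔄.ι S B‖ * (2 * J * 2 ^ #(box d ⌊R⌋₊)) ^ n *
        ∏ k ∈ range n, ((#S : ℝ) + k * #(box d ⌊R⌋₊)) := by
  have hJ0 : 0 ≤ J := (norm_nonneg _).trans (hJ ∅)
  induction n generalizing Λ' S B with
  | zero => simp
  | succ n ih =>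
    set m : ℕ := #(box d ⌊R⌋₊) with hm
    set N : Finset (Finset (Site d)) :=
      S.biUnion fun x => ((box d ⌊R⌋₊).image fun w => x + w).powerset with hN
    have hNP : N ⊆ (thicken Λ' R).powerset := fun X hX =>
      Finset.mem_powerset.2 (subset_thicken_of_mem_nbhd hS hX)
    rw [Function.iterate_succ_apply, hG, 𝔄.sum_comm_eq_sum_nbhd hR S B hNP, Finset.smul_sum]
    simp only [𝔄.comm_mem_range Φ S]
    rw [𝔄.iterate_genStep_sum Φ R hG]
    -- the bound for each chain step
    have hterm : ∀ X ∈ N,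
        ‖(G^[n] (thicken Λ' R, 𝔄.ι (S ∪ X)
          (I • (embedOp subset_union_right (Φ X) * embedOp subset_union_left B -
            embedOp subset_union_left B * embedOp subset_union_right (Φ X))))).2‖ ≤
        2 * J * ‖𝔄.ι S B‖ * (2 * J * 2 ^ m) ^ n *
          ∏ k ∈ range n, ((#S : ℝ) + (k + 1) * m) := by
      intro X hX
      have hSX : S ∪ X ⊆ thicken Λ' R :=
        Finset.union_subset (hS.trans (subset_thicken Λ' R)) (subset_thicken_of_mem_nbhd hS hX)
      refine (ih (thicken Λ' R) (S ∪ X) hSX _).trans ?_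
      have h1 : ‖𝔄.ι (S ∪ X) (I • (embedOp subset_union_right (Φ X) * embedOp subset_union_left B -
          embedOp subset_union_left B * embedOp subset_union_right (Φ X)))‖ ≤
          2 * J * ‖𝔄.ι S B‖ := by
        rw [← 𝔄.comm_mem_range Φ S X B, norm_smul, Complex.norm_I, one_mul]
        refine (norm_sub_le _ _).trans ?_
        refine (add_le_add (norm_mul_le _ _) (norm_mul_le _ _)).trans ?_
        rw [mul_comm ‖𝔄.ι S B‖, ← two_mul, ← mul_assoc]
        exact mul_le_mul_of_nonneg_right (mul_le_mul_of_nonneg_left (hJ X) zero_le_two)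
          (norm_nonneg _)
      have h2 : ∏ k ∈ range n, ((#(S ∪ X) : ℝ) + k * m) ≤
          ∏ k ∈ range n, ((#S : ℝ) + (k + 1) * m) := by
        refine Finset.prod_le_prod (fun k _ => by positivity) fun k _ => ?_
        have : (#(S ∪ X) : ℝ) ≤ #S + m := by
          exact_mod_cast (Finset.card_union_le S X).trans
            (Nat.add_le_add_left (card_le_of_mem_nbhd hX) _)
        linarith
      calc ‖𝔄.ι (S ∪ X) (I • (embedOp subset_union_right (Φ X) * embedOp subset_union_left B -
            embedOp subset_union_left B * embedOp subset_union_right (Φ X)))‖ *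
            (2 * J * 2 ^ m) ^ n * ∏ k ∈ range n, ((#(S ∪ X) : ℝ) + k * m)
          ≤ (2 * J * ‖𝔄.ι S B‖) * (2 * J * 2 ^ m) ^ n *
              ∏ k ∈ range n, ((#S : ℝ) + (k + 1) * m) := by
            refine mul_le_mul (mul_le_mul_of_nonneg_right h1 (by positivity)) h2
              (Finset.prod_nonneg fun k _ => by positivity) (by positivity)
        _ = _ := by ring
    refine (norm_sum_le _ _).trans ?_
    refine (Finset.sum_le_card_nsmul _ _ _ hterm).trans ?_
    rw [nsmul_eq_mul]
    have hcard : (#N : ℝ) ≤ #S * 2 ^ m := by exact_mod_cast card_nbhd_le S R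
    calc (#N : ℝ) * (2 * J * ‖𝔄.ι S B‖ * (2 * J * 2 ^ m) ^ n *
          ∏ k ∈ range n, ((#S : ℝ) + (k + 1) * m))
        ≤ (#S * 2 ^ m) * (2 * J * ‖𝔄.ι S B‖ * (2 * J * 2 ^ m) ^ n *
          ∏ k ∈ range n, ((#S : ℝ) + (k + 1) * m)) :=
          mul_le_mul_of_nonneg_right hcard (mul_nonneg (by positivity)
            (Finset.prod_nonneg fun k _ => by positivity))
      _ = ‖𝔄.ι S B‖ * (2 * J * 2 ^ m) ^ (n + 1) *
          ∏ k ∈ range (n + 1), ((#S : ℝ) + k * m) := by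
          rw [Finset.prod_range_succ' (fun k => ((#S : ℝ) + k * m))]
          push_cast
          ring

/-- **Analyticity bound** for local elements: `‖δ^n(ι_Λ A)‖ ≤ ‖ι_Λ A‖ e^{|Λ|} n! Kⁿ` with
`K = 2 J 2^m e^m` independent of `Λ` (from `norm_iterate_genStep_le` and `xⁿ/n! ≤ eˣ`).
Ruelle (1969) Lemma 7.6.1, eq. (6.4), p. 169; Bratteli–Robinson II Thm. 6.2.4 (proof).
[cite: Ruelle1969, Lemma 7.6.1, eq. (6.4), p. 169] -/
theorem norm_iterate_genStep_le_factorial {J : ℝ} (hR : Φ.HasFiniteRange R)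
    (hJ : ∀ X : Finset (Site d), ‖𝔄.ι X (Φ X)‖ ≤ J) (Λ : Finset (Site d)) (A : Op ↥Λ q) (n : ℕ) :
    ‖(G^[n] (Λ, 𝔄.ι Λ A)).2‖ ≤
      ‖𝔄.ι Λ A‖ * Real.exp #Λ * n ! *
        (2 * J * 2 ^ #(box d ⌊R⌋₊) * Real.exp #(box d ⌊R⌋₊)) ^ n := by
  have hJ0 : 0 ≤ J := (norm_nonneg _).trans (hJ ∅)
  set m : ℕ := #(box d ⌊R⌋₊) with hm
  refine (𝔄.norm_iterate_genStep_le Φ R hG hR hJ n Λ Λ subset_rfl A).trans ?_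
  have hprod : ∏ k ∈ range n, ((#Λ : ℝ) + k * m) ≤ n ! * (Real.exp #Λ * Real.exp m ^ n) := by
    have h1 : ∏ k ∈ range n, ((#Λ : ℝ) + k * m) ≤ ((#Λ : ℝ) + n * m) ^ n := by
      refine (Finset.prod_le_prod (fun k _ => by positivity) fun k hk => ?_).trans_eq
        (by rw [Finset.prod_const, Finset.card_range])
      have : (k : ℝ) ≤ n := by exact_mod_cast (Finset.mem_range.1 hk).le
      nlinarith [show (0 : ℝ) ≤ m from by positivity]
    have h2 : ((#Λ : ℝ) + n * m) ^ n / n ! ≤ Real.exp #Λ * Real.exp m ^ n := by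
      rw [← Real.exp_nat_mul, ← Real.exp_add]
      exact Real.pow_div_factorial_le_exp _ (by positivity) n
    rw [div_le_iff₀ (by positivity)] at h2
    linarith
  calc ‖𝔄.ι Λ A‖ * (2 * J * 2 ^ m) ^ n * ∏ k ∈ range n, ((#Λ : ℝ) + k * m)
      ≤ ‖𝔄.ι Λ A‖ * (2 * J * 2 ^ m) ^ n * (n ! * (Real.exp #Λ * Real.exp m ^ n)) :=
        mul_le_mul_of_nonneg_left hprod (by positivity)
    _ = _ := by ring

end Iterate

section Unique

variable (𝔄 : QuasiLocalAlgebra d q) (Φ : LatticeInteraction d q) (R : ℝ)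

/-- **Uniqueness of the dynamics** (the `∃!` half of Bratteli–Robinson II Thm. 6.2.4): two strongly
continuous automorphism groups whose generators are the commutator derivation of the same
finite-range interaction `Φ` (with `‖ι_X(Φ X)‖` bounded) on the local algebra coincide. Local
elements are analytic with a uniform radius `1/K` (`norm_iterate_genStep_le_factorial`), so both
groups are given by the same Taylor series for `|t| K < 1` on the dense local algebra; the group
law extends the equality to all `t`. Bratteli–Robinson II Thm. 6.2.4 (uniqueness); Ruelle (1969)
Thm. 7.6.2, pp. 169–170; Sakai (1991) §4.1, p. 118. [cite: BratteliRobinsonII1997, Thm. 6.2.4] -/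
theorem IsDynamicsOf.eq_of_isDynamicsOf {τ σ : ℝ → (𝔄.carrier ≃⋆ₐ[ℂ] 𝔄.carrier)} {J : ℝ}
    (hτ : 𝔄.IsDynamicsOf τ Φ R) (hσ : 𝔄.IsDynamicsOf σ Φ R) (hR : Φ.HasFiniteRange R)
    (hJ : ∀ X : Finset (Site d), ‖𝔄.ι X (Φ X)‖ ≤ J) : τ = σ := by
  have hJ0 : 0 ≤ J := (norm_nonneg _).trans (hJ ∅)
  set K : ℝ := 2 * J * 2 ^ #(box d ⌊R⌋₊) * Real.exp #(box d ⌊R⌋₊) with hK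
  have hK0 : 0 ≤ K := by positivity
  -- Step 1: agreement on local elements for small times
  have step1 : ∀ t : ℝ, |t| * K < 1 → ∀ (Λ : Finset (Site d)) (A : Op ↥Λ q),
      τ t (𝔄.ι Λ A) = σ t (𝔄.ι Λ A) := by
    intro t ht Λ A
    -- the iterated generator with its growing region (see the section `Iterate`)
    obtain ⟨G, hG⟩ : ∃ G : Finset (Site d) × 𝔄.carrier → Finset (Site d) × 𝔄.carrier,
        ∀ (Λ' : Finset (Site d)) (y : 𝔄.carrier), G (Λ', y) =
          (thicken Λ' R, I • ∑ X ∈ (thicken Λ' R).powerset,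
            (𝔄.ι X (Φ X) * y - y * 𝔄.ι X (Φ X))) :=
      ⟨fun p => (thicken p.1 R, I • ∑ X ∈ (thicken p.1 R).powerset,
        (𝔄.ι X (Φ X) * p.2 - p.2 * 𝔄.ι X (Φ X))), fun _ _ => rfl⟩
    set x : ℕ → 𝔄.carrier := fun n => (G^[n] (Λ, 𝔄.ι Λ A)).2 with hx
    have hx0 : x 0 = 𝔄.ι Λ A := rfl
    have hb : ∀ n, ‖x n‖ ≤ ‖𝔄.ι Λ A‖ * Real.exp #Λ * n ! * K ^ n :=
      fun n => 𝔄.norm_iterate_genStep_le_factorial Φ R (G := G) hG hR hJ Λ A n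
    have h1 := hτ.1.tendsto_taylor x
      (fun n => hτ.hasDerivAt_iterate_genStep 𝔄 Φ R (G := G) hG Λ A n) hK0 hb ht
    have h2 := hσ.1.tendsto_taylor x
      (fun n => hσ.hasDerivAt_iterate_genStep 𝔄 Φ R (G := G) hG Λ A n) hK0 hb ht
    exact tendsto_nhds_unique h1 h2
  -- Step 2: agreement for small times, by density of the local algebra
  have step2 : ∀ t : ℝ, |t| * K < 1 → τ t = σ t := by
    intro t ht
    have hcl : IsClosed {a : 𝔄.carrier | τ t a = σ t a} :=
      isClosed_eq (StarAlgEquiv.isometry (τ t)).continuous (StarAlgEquiv.isometry (σ t)).continuous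
    have hsub : (⋃ Λ : Finset (Site d), Set.range (𝔄.ι Λ)) ⊆ {a | τ t a = σ t a} := by
      intro a ha
      obtain ⟨Λ, ⟨A, rfl⟩⟩ := Set.mem_iUnion.1 ha
      exact step1 t ht Λ A
    have huniv : {a : 𝔄.carrier | τ t a = σ t a} = Set.univ := by
      refine Set.eq_univ_of_univ_subset ?_
      rw [← 𝔄.dense_range.closure_eq]
      exact hcl.closure_subset_iff.2 hsub
    ext a
    have : a ∈ {a : 𝔄.carrier | τ t a = σ t a} := huniv ▸ Set.mem_univ a
    exact this
  -- Step 3: all times, by the group law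
  funext t
  obtain ⟨N, hN⟩ := exists_nat_gt (|t| * K)
  have hN0 : (0 : ℝ) < N + 1 := by positivity
  set t₀ : ℝ := t / (N + 1) with ht₀
  have ht₀K : |t₀| * K < 1 := by
    rw [ht₀, abs_div, abs_of_pos hN0, div_mul_eq_mul_div, div_lt_one hN0]
    linarith
  have hk : ∀ k : ℕ, τ (k * t₀) = σ (k * t₀) := by
    intro k
    induction k with
    | zero => simp [hτ.1.1, hσ.1.1]
    | succ k ih =>
      rw [Nat.cast_add, Nat.cast_one, add_mul, one_mul, hτ.1.2.1, hσ.1.2.1, ih, step2 t₀ ht₀K]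
  have ht : t = ((N + 1 : ℕ) : ℝ) * t₀ := by
    rw [ht₀]; push_cast; field_simp
  rw [ht]
  exact hk (N + 1)

end Unique

/-! ### Covariance under translations -/

/-- **The translated dynamics is again a dynamics of `Φ`.** For a translation-invariant
interaction, `σ_t = shift_v⁻¹ ∘ τ_t ∘ shift_v` satisfies the defining property `IsDynamicsOf σ Φ R`
whenever `τ` does: the generator is covariant, `shift_v(ι_{Λ_R}(δ_Λ A)) = ι_{Λ_R+v}(δ_{Λ+v}(A^v))`.
Bratteli–Robinson II Thm. 6.2.4, eq. (6.2.11) (proof); Ruelle (1969) p. 170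
(`τ_x τ̄_t = τ̄_t τ_x`). [cite: Ruelle1969, Thm. 7.6.3 (proof), p. 170] -/
theorem IsDynamicsOf.conj_shift {𝔄 : QuasiLocalAlgebra d q}
    {τ : ℝ → (𝔄.carrier ≃⋆ₐ[ℂ] 𝔄.carrier)} {Φ : LatticeInteraction d q} {R : ℝ}
    (hτ : 𝔄.IsDynamicsOf τ Φ R) (hΦ : Φ.IsTranslationInvariant) (v : Site d) :
    𝔄.IsDynamicsOf (fun t => ((𝔄.shift v).trans (τ t)).trans (𝔄.shift v).symm) Φ R := by
  refine ⟨⟨?_, ?_, ?_⟩, ?_⟩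
  · ext a
    simp [hτ.1.map_zero_apply]
  · intro s t
    ext a
    simp [hτ.1.map_add_apply]
  · intro a
    exact (StarAlgEquiv.isometry (𝔄.shift v).symm).continuous.comp (hτ.1.2.2 (𝔄.shift v a))
  · intro Λ A
    have hd := hτ.2 (Λ.map (Site.shift v).toEmbedding)
      (transportOp (finsetMapEquiv (Site.shift v).toEmbedding Λ) A)
    rw [← 𝔄.shift_ι] at hd
    have hd' := hasDerivAt_starAlgEquiv_apply (𝔄.shift v).symm hd
    simp only [StarAlgEquiv.trans_apply]
    refine hd'.congr_deriv ?_
    -- covariance of the generator, computed inside `𝔄`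
    suffices hcov : 𝔄.ι (thicken (Λ.map (Site.shift v).toEmbedding) R)
        (derivation Φ R (Λ.map (Site.shift v).toEmbedding)
          (transportOp (finsetMapEquiv (Site.shift v).toEmbedding Λ) A)) =
        𝔄.shift v (𝔄.ι (thicken Λ R) (derivation Φ R Λ A)) by
      rw [hcov, StarAlgEquiv.symm_apply_apply]
    rw [𝔄.ι_derivation, 𝔄.ι_derivation, ← 𝔄.shift_ι, map_smul, map_sum, thicken_map_shift]
    congr 1
    symm
    refine Finset.sum_nbij' (fun Y => Y.map (Site.shift v).toEmbedding)
      (fun X => X.map (Site.shift (-v)).toEmbedding) ?_ ?_ ?_ ?_ ?_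
    · intro Y hY
      exact Finset.mem_powerset.2 (Finset.map_subset_map.2 (Finset.mem_powerset.1 hY))
    · intro X hX
      rw [Finset.mem_powerset] at hX ⊢
      have := Finset.map_subset_map (f := (Site.shift (-v)).toEmbedding).2 hX
      rwa [map_shift_map_shift_neg] at this
    · intro Y _
      exact map_shift_map_shift_neg Y v
    · intro X _
      exact map_shift_neg_map_shift X v
    · intro Y _
      rw [map_sub, map_mul, map_mul, 𝔄.shift_ι v Y (Φ Y), ← hΦ v Y]

/-- **In `𝔄`, a translation-invariant finite-range interaction is bounded**:
`‖ι_X(Φ X)‖ ≤ Σ_{Y ⊆ box ⌊R⌋} ‖ι_Y(Φ Y)‖` for every `X` (translate a point of `X` to the origin;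
translations are isometric ⋆-automorphisms). Bratteli–Robinson II §6.2.1. [folklore] -/
theorem norm_ι_le_of_isTranslationInvariant (𝔄 : QuasiLocalAlgebra d q)
    {Φ : LatticeInteraction d q} {R : ℝ} (hΦ : Φ.IsTranslationInvariant)
    (hR : Φ.HasFiniteRange R) (X : Finset (Site d)) :
    ‖𝔄.ι X (Φ X)‖ ≤ ∑ Y ∈ (box d ⌊R⌋₊).powerset, ‖𝔄.ι Y (Φ Y)‖ := by
  have key : ∀ (x : Site d), ∀ X₀ ⊆ box d ⌊R⌋₊,
      ‖𝔄.ι (X₀.map (Site.shift x).toEmbedding)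
        (Φ (X₀.map (Site.shift x).toEmbedding))‖ ≤
        ∑ Y ∈ (box d ⌊R⌋₊).powerset, ‖𝔄.ι Y (Φ Y)‖ := by
    intro x X₀ hX₀
    rw [hΦ x X₀, ← 𝔄.shift_ι, StarAlgEquiv.norm_map]
    exact Finset.single_le_sum (f := fun Y => ‖𝔄.ι Y (Φ Y)‖) (fun Y _ => norm_nonneg _)
      (Finset.mem_powerset.2 hX₀)
  by_cases h0 : Φ X = 0
  · rw [h0, map_zero, norm_zero]
    exact Finset.sum_nonneg fun Y _ => norm_nonneg _
  rcases X.eq_empty_or_nonempty with hX | ⟨x, hx⟩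
  · have := key 0 X (by rw [hX]; exact Finset.empty_subset _)
    rwa [show X.map (Site.shift (0 : Site d)).toEmbedding = X from by
      convert Finset.map_refl (s := X); ext y; simp] at this
  · have hsub := hR.subset_image_box h0 hx
    have hX₀ : X.map (Site.shift (-x)).toEmbedding ⊆ box d ⌊R⌋₊ := by
      intro y hy
      obtain ⟨z, hz, rfl⟩ := Finset.mem_map.1 hy
      obtain ⟨w, hw, rfl⟩ := Finset.mem_image.1 (hsub hz)
      simpa using hw
    have := key x _ hX₀
    rwa [map_shift_neg_map_shift] at this

/-- **Discharge of `IsDynamicsOf.shift_comm`**: the dynamics of a translation-invariant finite-range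
interaction commutes with the lattice translations, `τ_t ∘ shift_v = shift_v ∘ τ_t`. Proof:
`shift_v⁻¹ ∘ τ_t ∘ shift_v` is again a dynamics of `Φ` (`IsDynamicsOf.conj_shift`), and the dynamics
is unique (`IsDynamicsOf.eq_of_isDynamicsOf`, analyticity of local elements with the uniform
radius of Ruelle's Lemma 7.6.1). Bratteli–Robinson II Thm. 6.2.4, eq. (6.2.11); Ruelle (1969)
Thm. 7.6.2 and p. 170 (`τ_x τ̄_t = τ̄_t τ_x`). [cite: BratteliRobinsonII1997, Thm. 6.2.4 eq. (6.2.11)] -/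
theorem IsDynamicsOf.shift_comm_holds : IsDynamicsOf.shift_comm (d := d) (q := q) := by
  intro 𝔄 τ Φ R h hΦ hR t v a
  have hJ := 𝔄.norm_ι_le_of_isTranslationInvariant hΦ hR
  have heq := h.eq_of_isDynamicsOf 𝔄 Φ R (h.conj_shift hΦ v) hR hJ
  have h1 := congrArg (fun (f : ℝ → (𝔄.carrier ≃⋆ₐ[ℂ] 𝔄.carrier)) => 𝔄.shift v (f t a)) heq
  simp only [StarAlgEquiv.trans_apply, StarAlgEquiv.apply_symm_apply] at h1
  exact h1.symm

end QuasiLocalAlgebra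

end QLattice

end Literature.MathematicalPhysics.QuantumLattice
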